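import Summits.HodgeConjecture.HodgeConjecture.Theorems.F0P3JacquetEmbeddingDichotomy   -- ★ D2′ `isSupercuspidal_or_exists_injective_intertwiningMap_cmPrincipalSeries_of_irrClass`
import Literature.NumberTheory.Rogawski1990.Ch12Sec6                                 -- ★ the carpet: `EllipticClassification`, `IsEllipticPair`, `IsEllipticRep` (over ★ `Ch12Sec5Defs`)
import Literature.NumberTheory.Rogawski1990.Ch12Sec5Inputs                           -- ★ `EllipticData.LdsCardTwo` ((LDS2), a socket of the ★ l.d.s. fields)
import Literature.NumberTheory.Automorphic.IrreducibleClassesConstituents             -- ★ `IrrClass.IsConstituentOf.of_injective`, `isConstituentOf_mk_self`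
import HarnessLib

/-!
# F0 · P3c · line LH6 «StCharTS» — brick «ELL-CLASS ⟸ RED-JH★» (datum road, stage A of offer (α)): THE NAMED INPUT `EllipticClassification`
# («elliptic ⇒ supercuspidal or one of the three kinds of pairs», §12.6 p. 187) DERIVED FROM THE §12.2 LIST OF REDUCIBLE PRINCIPAL SERIES

Cell `hodgecm-mathlib`, crux `H413` (`stmt-HodgeConjecture-24833`), line LH6 `Cruxes/H413/Lines/F0_P3c_StCharTSPaydown.lean` (organ (S-𝔇) `stub_EllipticPackage`,
re-lettered through the junction ★ `Theorems/F0P3cStCharTSDatumJunction*.lean`, whose NAMED INPUT `hEllClass : Ch12Sec6.EllipticClassification 𝔇` this file turns into a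
CONSEQUENCE of field-level hypotheses plus ONE print-exact list).  Seat LH6-p03 (g4); THEOREMS ONLY (no `def`, no named fact, no `instance`, no notation, no `sorry`; axioms ⊆
{propext, Classical.choice, Quot.sound}); `--supports stmt-HodgeConjecture-24833`.  HONEST LABEL: HC_CM is proved only modulo the 7 printed citations (2 remaining: hLiu418 =
stmt-HodgeConjecture-24832, h413 = stmt-HodgeConjecture-24833) until rung 0 closes; count-neutral datum-road brick, closes no organ.

THE MATHEMATICS ([Rogawski1990, §12.6 p. 187 «an elliptic representation is either supercuspidal or a constituent of a reducible principal series … of one of the three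
types»; §12.2 pp. 172–174 (the list of reducible `i_G(χ)` and their Jordan–Hölder sets: `{ψ∘det_G, St_G(ψ)}`, `{π²(ξ), πⁿ(ξ)}`, the l.d.s. packets `Π(θ)`); §12.1
pp. 171–172 (Jacquet: a non-supercuspidal class embeds in some `i_G(χ)`)]; [Keys1984, §7]; [vanDijk1972, Thm. p. 237]).  Let `π` be elliptic (`χ_π ≢ 0` on `G^e`).  If `π` is
not supercuspidal, ★ D2′ embeds it into a continuous `i_G(χ₁, χ₂)`; that principal series is REDUCIBLE, for the character of a constituent of an IRREDUCIBLE `i_G(χ)` is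
`Θ_{i_G(χ)}`, which vanishes on `G^e` (van Dijk; hypothesis `hVan` = ★ PS-VANISH `char_eq_zero_on_ellG_of_isConstituentOf_irreducible`'s conclusion, LH6-p04 (g6)); the
§12.2 list (`hRedJH`) then says `JH(i_G(χ))` is an l.d.s. packet `P` (whose other member is the mate, (LDS2) `LdsCardTwo`), or `{St_G(ψ), ψ∘det_G}`, or `{π²(ξ′), πⁿ(ξ′)}` — in
each case `π` has a mate `π′` with `IsEllipticPair π π′`: **`ellipticClassification_of_redJH`**.

* §1 THE HEAD `ellipticClassification_of_redJH` — `EllipticClassification 𝔇` from `hVan`, `hLds2 : 𝔇.LdsCardTwo` and the list `hRedJH` (generic endoscopic side `H`).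

## References
* [Rogawski1990] J. D. Rogawski, *Automorphic Representations of Unitary Groups in Three Variables*, Ann. of Math. Stud. 123 (1990): §12.1 pp. 171–172, §12.2 pp. 172–174,
  §12.6 p. 187.
* [Keys1984] D. Keys, *Principal series representations of special unitary groups over local fields*, Compositio Math. 51 (1984): §7 Thm. p. 126.
* [vanDijk1972] G. van Dijk, *Computation of certain induced characters of p-adic groups*, Math. Ann. 199 (1972): Thm. p. 237.
-/

set_option autoImplicit false
-- the mandated namespace has the single-problem summit's repeated segment (`HodgeConjecture.HodgeConjecture`)
set_option linter.dupNamespace false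

noncomputable section

open NumberField IsDedekindDomain MeasureTheory
open scoped Matrix

open Literature.NumberTheory Literature.NumberTheory.Automorphic Literature.NumberTheory.Automorphic.UnitaryGroup
open Literature.NumberTheory.Rogawski1990

namespace Summit.HodgeConjecture.HodgeConjecture.Cruxes.H413.F0P3cStCharTSEllClass

variable (L : Type) [Field L] [NumberField L] [IsCMField L]

/-! ## §1 THE HEAD — the elliptic classification from the §12.2 list -/

set_option synthInstance.maxHeartbeats 400000 in
set_option maxHeartbeats 4000000 in
-- statement-heavy: every `π.IsConstituentOf (cmPrincipalSeries …)` token re-checks the `Gqs`↔carrier defeq (same class as ★ PAR-FIELD's 4000000)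
/-- **«ELL-CLASS ⟸ RED-JH★» — the elliptic classification of §12.6 from the §12.2 list of reducible principal series.**  For a §12.5 datum
`𝔇 : EllipticData (U(Φ₃)(L⁺_v)) H` at a NON-SPLIT `v`: IF (`hVan`) the character of every constituent of every IRREDUCIBLE continuous `i_G(χ₁, χ₂)` vanishes on `𝔇.ellG`
(★ PS-VANISH, van Dijk), (`hLds2`) every l.d.s. packet has exactly two members ((LDS2) ★ `LdsCardTwo`), and (`hRedJH`) the Jordan–Hölder set of every REDUCIBLE continuous
`i_G(χ₁, χ₂)` is an l.d.s. packet of `𝔇`, or `{𝔇.stG ψ, 𝔇.detG ψ}` (`ψ` a continuous character of `Z(G)`), or `{𝔇.pi2 ξ′, 𝔇.piN ξ′}` (`ξ′` a continuous character of `H`)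
— the §12.2 list pp. 172–174 read on the datum's fields — THEN `Ch12Sec6.EllipticClassification 𝔇`: every elliptic class is supercuspidal or has a mate `π′` with
`𝔇.IsEllipticPair π π′`.  Proof: ★ D2′ (Jacquet) embeds a non-supercuspidal `π` in some continuous `i_G(χ)`, reducible by `hVan` (else `χ_π ≡ 0` on `G^e`), and the three
branches of `hRedJH` give the three kinds of ★ `IsEllipticPair` (the l.d.s. mate by `hLds2`).
[cite: Rogawski1990, §12.6 p. 187; §12.2 pp. 172–174; §12.1 pp. 171–172] [cite: Keys1984, §7 Thm. p. 126] [cite: vanDijk1972, Thm. p. 237] -/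
theorem ellipticClassification_of_redJH (v : HeightOneSpectrum (𝓞 ↥(maximalRealSubfield L)))
    (hns : ∀ w : PlacesOver L v, IsCMField.complexConj L • w.1 = w.1)
    [MeasurableSpace (Gqs L v)] [∀ γ : Gqs L v, MeasurableSpace (Gqs L v ⧸ Subgroup.centralizer ({γ} : Set (Gqs L v)))]
    [MeasurableSpace (Gqs L v ⧸ Subgroup.center (Gqs L v))]
    {H : Type} [Group H] [TopologicalSpace H] [IsTopologicalGroup H] [MeasurableSpace H]
    (𝔇 : Ch12Sec5.EllipticData (Gqs L v) H)
    (hVan : ∀ (π : IrrClass (Gqs L v)) (χ₁ : (UnitaryGroup.LocalRing L v)ˣ →* ℂˣ) (χ₂ : ↥(normOneUnits (conjLocal L (IsCMField.complexConj L) v)) →* ℂˣ),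
      Continuous (fun x => ((χ₁ x : ℂˣ) : ℂ)) → Continuous (fun x => ((χ₂ x : ℂˣ) : ℂ)) →
      (UnitaryGroup.cmPrincipalSeries L 3 v (UnitaryGroup.cmTorusCharPair L v χ₁ χ₂)).IsIrreducible →
      π.IsConstituentOf (UnitaryGroup.cmPrincipalSeries L 3 v (UnitaryGroup.cmTorusCharPair L v χ₁ χ₂)) →
      ∀ γ ∈ 𝔇.ellG, 𝔇.char π γ = 0)
    (hLds2 : 𝔇.LdsCardTwo)
    (hRedJH : ∀ (χ₁ : (UnitaryGroup.LocalRing L v)ˣ →* ℂˣ) (χ₂ : ↥(normOneUnits (conjLocal L (IsCMField.complexConj L) v)) →* ℂˣ),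
      Continuous (fun x => ((χ₁ x : ℂˣ) : ℂ)) → Continuous (fun x => ((χ₂ x : ℂˣ) : ℂ)) →
      ¬ (UnitaryGroup.cmPrincipalSeries L 3 v (UnitaryGroup.cmTorusCharPair L v χ₁ χ₂)).IsIrreducible →
      (∃ P ∈ 𝔇.ldsPackets, ∀ c : IrrClass (Gqs L v),
          c.IsConstituentOf (UnitaryGroup.cmPrincipalSeries L 3 v (UnitaryGroup.cmTorusCharPair L v χ₁ χ₂)) ↔ c ∈ P) ∨
      (∃ ψ : ↥(Subgroup.center (Gqs L v)) →* ℂˣ, Continuous ψ ∧ ∀ c : IrrClass (Gqs L v),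
          c.IsConstituentOf (UnitaryGroup.cmPrincipalSeries L 3 v (UnitaryGroup.cmTorusCharPair L v χ₁ χ₂)) ↔ (c = 𝔇.stG ψ ∨ c = 𝔇.detG ψ)) ∨
      (∃ ξ' : H →* ℂˣ, Continuous ξ' ∧ ∀ c : IrrClass (Gqs L v),
          c.IsConstituentOf (UnitaryGroup.cmPrincipalSeries L 3 v (UnitaryGroup.cmTorusCharPair L v χ₁ χ₂)) ↔ (c = 𝔇.pi2 ξ' ∨ c = 𝔇.piN ξ'))) :
    Ch12Sec6.EllipticClassification 𝔇 := by
  intro π hπ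
  rcases F0P3JacquetEmbeddingDichotomy.isSupercuspidal_or_exists_injective_intertwiningMap_cmPrincipalSeries_of_irrClass L v hns π with
    hsc | ⟨r, hr, χ₁, χ₂, h1, h2, φ, hφ⟩
  · exact Or.inl hsc
  · right
    -- `π` is a constituent of the continuous principal series `i_G(χ₁, χ₂)` (Jacquet, ★ D2′)
    have hc : π.IsConstituentOf (UnitaryGroup.cmPrincipalSeries L 3 v (UnitaryGroup.cmTorusCharPair L v χ₁ χ₂)) := by
      rw [← hr]
      exact (IrrClass.isConstituentOf_mk_self r).of_injective φ hφ
    -- which is REDUCIBLE: otherwise `χ_π` would vanish on `G^e` (van Dijk), contradicting ellipticity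
    have hred : ¬ (UnitaryGroup.cmPrincipalSeries L 3 v (UnitaryGroup.cmTorusCharPair L v χ₁ χ₂)).IsIrreducible := by
      intro hirr
      obtain ⟨γ, hγ, hne⟩ := hπ
      exact hne (hVan π χ₁ χ₂ h1 h2 hirr hc γ hγ)
    -- the §12.2 list: three kinds
    rcases hRedJH χ₁ χ₂ h1 h2 hred with ⟨P, hP, hJH⟩ | ⟨ψ, hψ, hJH⟩ | ⟨ξ', hξ', hJH⟩
    · -- an l.d.s. packet `P ∋ π`; its other member is the mate ((LDS2))
      have hπP : π ∈ P := (hJH π).1 hc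
      obtain ⟨σ', hσ'P, -, hall⟩ := hLds2 P hP π hπP
      refine ⟨σ', Or.inl ⟨P, hP, fun σ => ⟨fun hσ => hall σ hσ, fun hσ => ?_⟩⟩⟩
      rcases hσ with rfl | rfl
      · exact hπP
      · exact hσ'P
    · -- `{St_G(ψ), ψ∘det_G}`
      rcases (hJH π).1 hc with hst | hdet
      · exact ⟨𝔇.detG ψ, Or.inr (Or.inl ⟨ψ, hψ, Or.inl ⟨hst, rfl⟩⟩)⟩
      · exact ⟨𝔇.stG ψ, Or.inr (Or.inl ⟨ψ, hψ, Or.inr ⟨hdet, rfl⟩⟩)⟩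
    · -- `{π²(ξ′), πⁿ(ξ′)}`
      rcases (hJH π).1 hc with h2' | hN
      · exact ⟨𝔇.piN ξ', Or.inr (Or.inr ⟨ξ', hξ', Or.inl ⟨h2', rfl⟩⟩)⟩
      · exact ⟨𝔇.pi2 ξ', Or.inr (Or.inr ⟨ξ', hξ', Or.inr ⟨hN, rfl⟩⟩)⟩

end Summit.HodgeConjecture.HodgeConjecture.Cruxes.H413.F0P3cStCharTSEllClass

end
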